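import Summits.CriticalPhenomena.PercolationContinuityZ3.Theorems.PercNearOneGluingNoHeavyLowerTailSahiGridPatternTwoLayerTop

/-!
# `NoHeavyLowerTail` (crux stmt-CriticalPhenomena-4575), Sahi programme: **TOP-SLICE DOMINANCE WHEN ONE SET IS TOP-ONLY, EVERY DIMENSION**

Support file (seat `prim-ineq-gen-4`, generation 11; `--supports stmt-CriticalPhenomena-4575`).  Pure proofs, no definitions, no `sorry`,
standard axioms.  Companion of `…SahiGridPatternTwoLayerTop` (same machinery: `block_eq`, `sStarD_counting`, fibre Kleitman `sum_ind_lat_le_td`).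

THEOREM (`two_mul_sStarD_top_le_of_topOnly`): if the up-set `A ⊆ [3]^{n+1}` is supported on the top level of the last axis (its level-0 and
level-1 slices are empty) and `B, C ⊆ [3]^{n+1}` are ARBITRARY up-sets, then `2 · sStarD A₂ B₂ C₂ ≤ sStarD A B C` — the factor-2 top-slice
dominance (TOP) in the 'top-only' case, every dimension (memo `run/shared/lean/prim/prim-ineq-gen-4/FINDING-TOP-SLICE-DOMINANCE-g11.md` §2(a);
this case contains all tight cells of TOP at `n+1 = 2` and 96 % of them at `n+1 = 3`).  Proof: expand into the nine level blocks `(2,j,k)`; the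
Latin deficit `2·Lat(A₂,B₂,C₂) − Lat(A₂,B₀,C₁) − Lat(A₂,B₁,C₀)` is at most the `B`- and `C`-brackets by fibre Kleitman with the difference
sets `B₂∖B_i`, `C₂∖C_j` as the free argument; the `A`-bracket is monotone. [this work]
-/

namespace Summit.CriticalPhenomena.PercolationContinuityZ3.Theorems.SahiGridPattern

open Finset SahiGrid3
open scoped BigOperators

variable {n : ℕ}

/-! ### Top-slice dominance when one set is TOP-ONLY (the other two arbitrary) -/

/-- Indicator of a set difference of nested finsets. [this work] -/
theorem ind_sdiff_of_subset {Y : Type*} [DecidableEq Y] {s t : Finset Y} (h : s ⊆ t) (y : Y) : ind (t \ s) y = ind t y - ind s y := by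
  unfold ind
  by_cases hs : y ∈ s
  · rw [if_pos (h hs), if_pos hs, if_neg (by rw [Finset.mem_sdiff]; exact fun hh => hh.2 hs)]; ring
  · by_cases ht : y ∈ t
    · rw [if_pos ht, if_neg hs, if_pos (Finset.mem_sdiff.2 ⟨ht, hs⟩)]; ring
    · rw [if_neg ht, if_neg hs, if_neg (by rw [Finset.mem_sdiff]; exact fun hh => ht hh.1)]; ring

/-- Values of the per-axis counts with the first level equal to `2` (bookkeeping). [this work] -/
theorem c_vals_top :
    c1 (2:Fin 3) 0 0 = 0 ∧ c1 (2:Fin 3) 0 1 = 0 ∧ c1 (2:Fin 3) 0 2 = 0 ∧ c1 (2:Fin 3) 1 0 = 0 ∧ c1 (2:Fin 3) 1 1 = 0 ∧ c1 (2:Fin 3) 1 2 = 0 ∧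
    c1 (2:Fin 3) 2 0 = 0 ∧ c1 (2:Fin 3) 2 1 = 0 ∧ c1 (2:Fin 3) 2 2 = 2 ∧
    c2 (2:Fin 3) 0 0 = 1 ∧ c2 (2:Fin 3) 0 1 = 0 ∧ c2 (2:Fin 3) 0 2 = 0 ∧ c2 (2:Fin 3) 1 0 = 0 ∧ c2 (2:Fin 3) 1 1 = 1 ∧ c2 (2:Fin 3) 1 2 = 0 ∧
    c2 (2:Fin 3) 2 0 = 0 ∧ c2 (2:Fin 3) 2 1 = 0 ∧ c2 (2:Fin 3) 2 2 = 0 ∧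
    c2 (0:Fin 3) 2 0 = 0 ∧ c2 (0:Fin 3) 2 1 = 0 ∧ c2 (0:Fin 3) 2 2 = 1 ∧ c2 (1:Fin 3) 2 0 = 0 ∧ c2 (1:Fin 3) 2 1 = 0 ∧ c2 (1:Fin 3) 2 2 = 1 ∧
    c3 (2:Fin 3) 0 0 = 0 ∧ c3 (2:Fin 3) 0 1 = 1 ∧ c3 (2:Fin 3) 0 2 = 0 ∧ c3 (2:Fin 3) 1 0 = 1 ∧ c3 (2:Fin 3) 1 1 = 0 ∧ c3 (2:Fin 3) 1 2 = 0 ∧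
    c3 (2:Fin 3) 2 0 = 0 ∧ c3 (2:Fin 3) 2 1 = 0 ∧ c3 (2:Fin 3) 2 2 = 0 := by
  unfold c1 c2 c3; decide

/-- **TOP-SLICE DOMINANCE WHEN ONE SET IS TOP-ONLY** (every `n`): if the up-set `A ⊆ [3]^{n+1}` meets only the top level of the last axis
(`snoc q 0, snoc q 1 ∉ A` for all `q`) and `B, C` are arbitrary up-sets, then `2 · sStarD A₂ B₂ C₂ ≤ sStarD A B C`.
Proof (memo §2a): the Latin deficit `2 Lat(A₂,B₂,C₂) − Lat(A₂,B₀,C₁) − Lat(A₂,B₁,C₀)` is paid by the `B`- and `C`-brackets through fibre Kleitman with the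
difference sets `B₂∖B_i`, `C₂∖C_j` as free arguments; the `A`-bracket is monotone. [this work] -/
theorem two_mul_sStarD_top_le_of_topOnly (A B C : Finset (Pd (n + 1)))
    (hA : IsUpperSet (A : Set (Pd (n + 1)))) (hB : IsUpperSet (B : Set (Pd (n + 1)))) (hC : IsUpperSet (C : Set (Pd (n + 1))))
    (hA0 : ∀ q : Pd n, (Fin.snoc q 0 : Pd (n + 1)) ∉ A) (hA1 : ∀ q : Pd n, (Fin.snoc q 1 : Pd (n + 1)) ∉ A) :
    2 * sStarD (univ.filter fun q : Pd n => (Fin.snoc q 2 : Pd (n + 1)) ∈ A)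
          (univ.filter fun q : Pd n => (Fin.snoc q 2 : Pd (n + 1)) ∈ B)
          (univ.filter fun q : Pd n => (Fin.snoc q 2 : Pd (n + 1)) ∈ C) ≤ sStarD A B C := by
  -- the slices
  set U : Finset (Pd n) := univ.filter fun q : Pd n => (Fin.snoc q 2 : Pd (n + 1)) ∈ A with hUdef
  set V : Finset (Pd n) := univ.filter fun q : Pd n => (Fin.snoc q 2 : Pd (n + 1)) ∈ B with hVdef
  set W : Finset (Pd n) := univ.filter fun q : Pd n => (Fin.snoc q 2 : Pd (n + 1)) ∈ C with hWdef
  set v : Finset (Pd n) := univ.filter fun q : Pd n => (Fin.snoc q 1 : Pd (n + 1)) ∈ B with hvdef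
  set w : Finset (Pd n) := univ.filter fun q : Pd n => (Fin.snoc q 1 : Pd (n + 1)) ∈ C with hwdef
  set b : Finset (Pd n) := univ.filter fun q : Pd n => (Fin.snoc q 0 : Pd (n + 1)) ∈ B with hbdef
  set c : Finset (Pd n) := univ.filter fun q : Pd n => (Fin.snoc q 0 : Pd (n + 1)) ∈ C with hcdef
  have iU : ∀ p, ind A (Fin.snoc p 2) = ind U p := fun p => by rw [hUdef, ind_filter_snoc]
  have iV : ∀ p, ind B (Fin.snoc p 2) = ind V p := fun p => by rw [hVdef, ind_filter_snoc]
  have iW : ∀ p, ind C (Fin.snoc p 2) = ind W p := fun p => by rw [hWdef, ind_filter_snoc]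
  have iv : ∀ p, ind B (Fin.snoc p 1) = ind v p := fun p => by rw [hvdef, ind_filter_snoc]
  have iw : ∀ p, ind C (Fin.snoc p 1) = ind w p := fun p => by rw [hwdef, ind_filter_snoc]
  have ib : ∀ p, ind B (Fin.snoc p 0) = ind b p := fun p => by rw [hbdef, ind_filter_snoc]
  have ic : ∀ p, ind C (Fin.snoc p 0) = ind c p := fun p => by rw [hcdef, ind_filter_snoc]
  have iA0 : ∀ p, ind A (Fin.snoc p 0) = 0 := fun p => by unfold ind; rw [if_neg (hA0 p)]
  have iA1 : ∀ p, ind A (Fin.snoc p 1) = 0 := fun p => by unfold ind; rw [if_neg (hA1 p)]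
  -- up-set and nesting facts
  have hUup : IsUpperSet (U : Set (Pd n)) := by rw [hUdef]; exact isUpperSet_filter_snoc hA 2
  have hVup : IsUpperSet (V : Set (Pd n)) := by rw [hVdef]; exact isUpperSet_filter_snoc hB 2
  have hWup : IsUpperSet (W : Set (Pd n)) := by rw [hWdef]; exact isUpperSet_filter_snoc hC 2
  have nbV : ∀ p, ind b p ≤ ind V p := fun p => by rw [← ib, ← iV]; exact ind_snoc_mono hB p (by decide)
  have nvV : ∀ p, ind v p ≤ ind V p := fun p => by rw [← iv, ← iV]; exact ind_snoc_mono hB p (by decide)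
  have ncW : ∀ p, ind c p ≤ ind W p := fun p => by rw [← ic, ← iW]; exact ind_snoc_mono hC p (by decide)
  have nwW : ∀ p, ind w p ≤ ind W p := fun p => by rw [← iw, ← iW]; exact ind_snoc_mono hC p (by decide)
  have sbV : b ⊆ V := fun q hq => by
    have h1 := nbV q; unfold ind at h1; rw [if_pos hq] at h1
    by_contra hh; rw [if_neg hh] at h1; exact absurd h1 (by norm_num)
  have svV : v ⊆ V := fun q hq => by
    have h1 := nvV q; unfold ind at h1; rw [if_pos hq] at h1
    by_contra hh; rw [if_neg hh] at h1; exact absurd h1 (by norm_num)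
  have scW : c ⊆ W := fun q hq => by
    have h1 := ncW q; unfold ind at h1; rw [if_pos hq] at h1
    by_contra hh; rw [if_neg hh] at h1; exact absurd h1 (by norm_num)
  have swW : w ⊆ W := fun q hq => by
    have h1 := nwW q; unfold ind at h1; rw [if_pos hq] at h1
    by_contra hh; rw [if_neg hh] at h1; exact absurd h1 (by norm_num)
  -- the value of sStarD A B C
  have eA : sStarD A B C = 4 * 2 ^ n * (∑ p, ind U p * ind V p * ind W p)
      - (∑ p, ∑ q, ind U p * ind b q * ind c q * (if TotDist p q = true then (1:ℤ) else 0))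
      - (∑ p, ∑ q, ind U p * ind v q * ind w q * (if TotDist p q = true then (1:ℤ) else 0))
      - (∑ p, ∑ q, ind b p * ind U q * ind W q * (if TotDist p q = true then (1:ℤ) else 0))
      - (∑ p, ∑ q, ind v p * ind U q * ind W q * (if TotDist p q = true then (1:ℤ) else 0))
      - (∑ p, ∑ q, ind c p * ind U q * ind V q * (if TotDist p q = true then (1:ℤ) else 0))
      - (∑ p, ∑ q, ind w p * ind U q * ind V q * (if TotDist p q = true then (1:ℤ) else 0))
      + (∑ q, ∑ r, ind b q * ind w r * ind U (thirdPt q r) * (if TotDist q r = true then (1:ℤ) else 0))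
      + (∑ q, ∑ r, ind v q * ind c r * ind U (thirdPt q r) * (if TotDist q r = true then (1:ℤ) else 0)) := by
    rw [sStarD_eq_sum_ind]
    simp only [sum_snoc, Fin.sum_univ_three, iA0, iA1, iU, iV, iW, iv, iw, ib, ic, zero_mul,
      Finset.sum_const_zero, zero_add, Finset.sum_add_distrib]
    rw [block_eq, block_eq, block_eq, block_eq, block_eq, block_eq, block_eq, block_eq, block_eq]
    obtain ⟨a1, a2, a3, a4, a5, a6, a7, a8, a9, b1, b2, b3, b4, b5, b6, b7, b8, b9, d1, d2, d3, d4, d5, d6,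
      f1, f2, f3, f4, f5, f6, f7, f8, f9⟩ := c_vals_top
    rw [a1, a2, a3, a4, a5, a6, a7, a8, a9, b1, b2, b3, b4, b5, b6, b7, b8, b9, d1, d2, d3, d4, d5, d6,
      f1, f2, f3, f4, f5, f6, f7, f8, f9]
    ring
  have eT := sStarD_counting U V W
  -- the Latin deficits, bounded pointwise then by fibre Kleitman with the difference sets as free argument
  have split : ∀ (x X y Yy : Finset (Pd n)), (∀ p, ind x p ≤ ind X p) → (∀ p, ind y p ≤ ind Yy p) → x ⊆ X → y ⊆ Yy →
      (∑ q, ∑ r, ind X q * ind Yy r * ind U (thirdPt q r) * (if TotDist q r = true then (1:ℤ) else 0))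
        - (∑ q, ∑ r, ind x q * ind y r * ind U (thirdPt q r) * (if TotDist q r = true then (1:ℤ) else 0)) ≤
      (∑ q, ∑ r, ind (X \ x) q * ind Yy r * ind U (thirdPt q r) * (if TotDist q r = true then (1:ℤ) else 0))
        + (∑ q, ∑ r, ind (Yy \ y) q * ind X r * ind U (thirdPt q r) * (if TotDist q r = true then (1:ℤ) else 0)) := by
    intro x X y Yy hx hy sx sy
    have e2 : (∑ q, ∑ r, ind (Yy \ y) q * ind X r * ind U (thirdPt q r) * (if TotDist q r = true then (1:ℤ) else 0)) =
        ∑ q, ∑ r, ind X q * ind (Yy \ y) r * ind U (thirdPt q r) * (if TotDist q r = true then (1:ℤ) else 0) := by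
      rw [Finset.sum_comm]
      refine Finset.sum_congr rfl fun q _ => Finset.sum_congr rfl fun r _ => ?_
      rw [thirdPt_comm r q, totDist_symm r q]; ring
    rw [e2, ← Finset.sum_sub_distrib, ← Finset.sum_add_distrib]
    refine Finset.sum_le_sum fun q _ => ?_
    rw [← Finset.sum_sub_distrib, ← Finset.sum_add_distrib]
    refine Finset.sum_le_sum fun r _ => ?_
    rw [ind_sdiff_of_subset sx, ind_sdiff_of_subset sy]
    have h0 : 0 ≤ ind U (thirdPt q r) * (if TotDist q r = true then (1:ℤ) else 0) :=
      mul_nonneg (ind_nonneg' U _) (by split_ifs <;> norm_num)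
    have key : ind X q * ind Yy r - ind x q * ind y r ≤ (ind X q - ind x q) * ind Yy r + ind X q * (ind Yy r - ind y r) := by
      have h1 : 0 ≤ (ind X q - ind x q) * (ind Yy r - ind y r) := mul_nonneg (by linarith [hx q]) (by linarith [hy r])
      have h2 : 0 ≤ ind x q * (ind Yy r - ind y r) := mul_nonneg (ind_nonneg' x q) (by linarith [hy r])
      nlinarith [h1, h2, hx q, hy r, ind_nonneg' x q, ind_nonneg' y r]
    nlinarith [key, h0, mul_le_mul_of_nonneg_right key h0]
  have KB1 := sum_ind_lat_le_td (V \ b) hWup hUup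
  have KC1 := sum_ind_lat_le_td (W \ w) hVup hUup
  have KB2 := sum_ind_lat_le_td (V \ v) hWup hUup
  have KC2 := sum_ind_lat_le_td (W \ c) hVup hUup
  have S1 := split b V w W nbV nwW sbV swW
  have S2 := split v V c W nvV ncW svV scW
  -- rewrite the difference indicators in the Kleitman right-hand sides
  have eB1 : (∑ p, ∑ q, ind (V \ b) p * ind W q * ind U q * (if TotDist p q = true then (1:ℤ) else 0)) =
      (∑ p, ∑ q, ind V p * ind U q * ind W q * (if TotDist p q = true then (1:ℤ) else 0))
      - (∑ p, ∑ q, ind b p * ind U q * ind W q * (if TotDist p q = true then (1:ℤ) else 0)) := by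
    rw [← Finset.sum_sub_distrib]; refine Finset.sum_congr rfl fun p _ => ?_
    rw [← Finset.sum_sub_distrib]; refine Finset.sum_congr rfl fun q _ => ?_
    rw [ind_sdiff_of_subset sbV]; ring
  have eB2 : (∑ p, ∑ q, ind (V \ v) p * ind W q * ind U q * (if TotDist p q = true then (1:ℤ) else 0)) =
      (∑ p, ∑ q, ind V p * ind U q * ind W q * (if TotDist p q = true then (1:ℤ) else 0))
      - (∑ p, ∑ q, ind v p * ind U q * ind W q * (if TotDist p q = true then (1:ℤ) else 0)) := by
    rw [← Finset.sum_sub_distrib]; refine Finset.sum_congr rfl fun p _ => ?_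
    rw [← Finset.sum_sub_distrib]; refine Finset.sum_congr rfl fun q _ => ?_
    rw [ind_sdiff_of_subset svV]; ring
  have eC1 : (∑ p, ∑ q, ind (W \ w) p * ind V q * ind U q * (if TotDist p q = true then (1:ℤ) else 0)) =
      (∑ p, ∑ q, ind W p * ind U q * ind V q * (if TotDist p q = true then (1:ℤ) else 0))
      - (∑ p, ∑ q, ind w p * ind U q * ind V q * (if TotDist p q = true then (1:ℤ) else 0)) := by
    rw [← Finset.sum_sub_distrib]; refine Finset.sum_congr rfl fun p _ => ?_
    rw [← Finset.sum_sub_distrib]; refine Finset.sum_congr rfl fun q _ => ?_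
    rw [ind_sdiff_of_subset swW]; ring
  have eC2 : (∑ p, ∑ q, ind (W \ c) p * ind V q * ind U q * (if TotDist p q = true then (1:ℤ) else 0)) =
      (∑ p, ∑ q, ind W p * ind U q * ind V q * (if TotDist p q = true then (1:ℤ) else 0))
      - (∑ p, ∑ q, ind c p * ind U q * ind V q * (if TotDist p q = true then (1:ℤ) else 0)) := by
    rw [← Finset.sum_sub_distrib]; refine Finset.sum_congr rfl fun p _ => ?_
    rw [← Finset.sum_sub_distrib]; refine Finset.sum_congr rfl fun q _ => ?_
    rw [ind_sdiff_of_subset scW]; ring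
  rw [eB1] at KB1; rw [eB2] at KB2; rw [eC1] at KC1; rw [eC2] at KC2
  -- the A-bracket is monotone
  have MA1 : (∑ p, ∑ q, ind U p * ind b q * ind c q * (if TotDist p q = true then (1:ℤ) else 0)) ≤
      ∑ p, ∑ q, ind U p * ind V q * ind W q * (if TotDist p q = true then (1:ℤ) else 0) := by
    refine Finset.sum_le_sum fun p _ => Finset.sum_le_sum fun q _ => ?_
    have := mul_le_mul (nbV q) (ncW q) (ind_nonneg' c q) (ind_nonneg' V q)
    have h0 : 0 ≤ ind U p * (if TotDist p q = true then (1:ℤ) else 0) := mul_nonneg (ind_nonneg' U p) (by split_ifs <;> norm_num)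
    nlinarith [this, h0]
  have MA2 : (∑ p, ∑ q, ind U p * ind v q * ind w q * (if TotDist p q = true then (1:ℤ) else 0)) ≤
      ∑ p, ∑ q, ind U p * ind V q * ind W q * (if TotDist p q = true then (1:ℤ) else 0) := by
    refine Finset.sum_le_sum fun p _ => Finset.sum_le_sum fun q _ => ?_
    have := mul_le_mul (nvV q) (nwW q) (ind_nonneg' w q) (ind_nonneg' V q)
    have h0 : 0 ≤ ind U p * (if TotDist p q = true then (1:ℤ) else 0) := mul_nonneg (ind_nonneg' U p) (by split_ifs <;> norm_num)
    nlinarith [this, h0]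
  rw [eT, eA]
  linarith [KB1, KB2, KC1, KC2, S1, S2, MA1, MA2]


end Summit.CriticalPhenomena.PercolationContinuityZ3.Theorems.SahiGridPattern
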